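import Literature.AlgebraicGeometry.HodgeTheory.AbelianVarietyUniformisationPicard    -- ★ `picClass_cartierDivisorLineBundle_mem_picZero`, `_add/_neg/_eq_of_linEquiv`, translations
import Literature.AlgebraicGeometry.Motives.AbelianVarietyAmpleRiemannForm            -- ★ `picClass_cartierDivisorLineBundle_nsmul`, `AHData.pow_form`
import Literature.AlgebraicGeometry.Motives.AbelianVarietyPhiThetaFibres              -- ★ `AbelianVariety.cechClass_neg_eq_inv` (+ ★ `TheoremOfTheSquareCechPic`: `phiPic`)
import Literature.Geometry.Kaehler.ComplexTorusNeronSeveriPeriodMatrix                 -- ★ `intGram_add_of_isNSForm`, `map_intGram`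
import HarnessLib

/-!
# The Appell–Humbert form of a class with prescribed `φ`: `φ_{[D′]} = φ_{[D]}ⁿ ⇒ H′ = n·H`

Topic `AlgebraicGeometry/HodgeTheory`; namespaces `Literature.Geometry.Kaehler.ComplexTorus` (§1) and
`Literature.AlgebraicGeometry.HodgeTheory` (§§2–3).  KERNEL ONLY: theorems; no definition, no named fact, no instance, no
`sorry`.  Cell `hodgecm-mathlib`, (U)-lane node U-e P4, N3-core assembler junction (J) (P4 lead B-p03 (g14) 2026-08-29T15:53Z):
the torus-side reading of an ALGEBRAIC `φ`-identity.

* §1 (pure torus, [Lange2023AbelianVarietiesComplex] §1.3.1 Thm. 1.3.3 Appell–Humbert + §1.4.1 Prop. 1.4.1 `Pic⁰(X) = ker(c₁)`):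
  `Pic.nsForm_pow`; **`AHData.form_eq_nsmul_of_toPic_eq`** — if `[L(H′,χ′)] = [L(H,χ)]ⁿ · c` with `c ∈ Pic⁰(X)` then
  `H′ = n • H` (`c₁` is additive and kills `Pic⁰`).
* §2 (algebraic, any abelian variety over `ℂ`; [MumfordAV1970] §8, [Lange2023AbelianVarietiesComplex] §1.4.2 Prop. 1.4.6):
  `CartierDivisor.cechClass_nsmul` (`[𝒪(n • D)] = [𝒪(D)]ⁿ`) and **`AbelianVariety.linEquiv_pullback_translation_of_phiPic_eq_pow`** —
  if `φ_{[𝒪(D′)]}(x) = φ_{[𝒪(D)]}(x)ⁿ` for every `x ∈ A(ℂ)` then `D′ − n•D` is translation invariant: `t_x^*(D′ + (−(n • D))) ∼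
  D′ + (−(n • D))` for all `x`.
* §3 THE JUNCTION **`AbelianVariety.form_eq_nsmul_form_of_phiPic_cechClass_eq_pow`**: on a complex abelian variety `A`
  uniformised by `φ : V/Λ → A(ℂ)` (★ `IsAnalytification` + additivity), if `φ_{[𝒪(D′)]} = φ_{[𝒪(D)]}ⁿ` pointwise on `A(ℂ)`
  and `(H, χ)`, `(H′, χ′)` are the Appell–Humbert data of `𝒪(D)^an`, `𝒪(D′)^an`, then `H′ = n • H` — by §2, ★
  `picClass_cartierDivisorLineBundle_mem_picZero` ([MumfordAV1970] §8 (iv)⇒(i) read through ★ Lange §1.4.2), ★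
  `picClass_cartierDivisorLineBundle_add/_neg/_nsmul` and §1.  Consumer: the N3-core assembler reads `φ_{[L^Δ_y]} = φ_{Θ_y}²`
  (T1 ★ `phiPic_detClass_restrict_LDelta`) as `intGram` of `L^Δ_y` `= 2 •` `intGram` of `Θ_y` on every fibre torus.

## References
* [Lange2023AbelianVarietiesComplex] H. Lange, *Abelian Varieties over the Complex Numbers*, Springer 2023, §1.3.1 (1.10) and
  Thm. 1.3.3 (pp. 28–30), §1.4.1 Prop. 1.4.1 (p. 36), §1.4.2 Prop. 1.4.6 (b) (p. 38).
* [MumfordAV1970] D. Mumford, *Abelian Varieties*, §8 (the theorem of the square, `φ_L`, `K(L)`; (iv) ⇒ (i)) pp. 74–80.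
* [GortzWedhorn2020] U. Görtz, T. Wedhorn, *Algebraic Geometry I*, 2nd ed., Prop. 11.21 (p. 302), Def. 11.49 (p. 392).
-/

set_option autoImplicit false

noncomputable section

open Set Function CategoryTheory AlgebraicGeometry
open Literature.AlgebraicGeometry.Motives Literature.AlgebraicGeometry.Motives.RatFn
open Literature.Geometry.Kaehler Literature.Geometry.Kaehler.ComplexTorus
open Literature.NumberTheory.Transcendental
open Literature.AlgebraicGeometry.AbelianVarieties Literature.AlgebraicGeometry.Modules

/-! ### §1. Pure torus: `c₁` of powers and the Appell–Humbert form modulo `Pic⁰` -/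

namespace Literature.Geometry.Kaehler.ComplexTorus

section Torus

variable {ι : Type*} {E : Type*} [NormedAddCommGroup E] [NormedSpace ℂ E] {Φ : (ι → ℝ) ≃L[ℝ] E}
  [Fintype ι] [DecidableEq ι] [FiniteDimensional ℂ E]

/-- `E_{xⁿ} = n • E_x` (`c₁` is additive, ★ `Pic.nsForm_mul`). [cite: Lange2023AbelianVarietiesComplex, §1.2.2 Thm. 1.2.4 (p. 22)] -/
theorem Pic.nsForm_pow (x : Pic Φ) : ∀ n : ℕ, Pic.nsForm (x ^ n) = n • Pic.nsForm x
  | 0 => by rw [pow_zero, Pic.nsForm_one, zero_smul]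
  | n + 1 => by rw [pow_succ, Pic.nsForm_mul, Pic.nsForm_pow x n, add_smul, one_smul]

/-- **The Appell–Humbert form modulo `Pic⁰`**: if `[L(H′, χ′)] = [L(H, χ)]ⁿ · c` in `Pic(X)` with `c ∈ Pic⁰(X)` (`c₁(c) = 0`),
then `H′ = n • H` — `c₁(L(H, χ)) = H` (★ `AHData.nsForm_toPic`), `c₁` is a homomorphism killing `Pic⁰`.
[cite: Lange2023AbelianVarietiesComplex, §1.3.2 Thm. 1.3.3 and §1.4.1 Prop. 1.4.1 (pp. 30, 36)] -/
theorem AHData.form_eq_nsmul_of_toPic_eq (p p' : AHData Φ) (n : ℕ) {c : Pic Φ} (hc : c ∈ picZero Φ)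
    (h : AHData.toPic p' = AHData.toPic p ^ n * c) : p'.form = n • p.form := by
  rw [← AHData.nsForm_toPic p', h, Pic.nsForm_mul, Pic.nsForm_pow, AHData.nsForm_toPic, (mem_picZero_iff Φ c).1 hc,
    add_zero]

end Torus

section IntGram

variable {κ : Type*} [Fintype κ] [DecidableEq κ] {Φ : (κ ⊕ κ → ℝ) ≃L[ℝ] (κ → ℂ)}

/-- On `NS(X)` the integer Gram matrix of `n • η` is `n •` that of `η` (★ `intGram_add_of_isNSForm`, induction; stated in the
lattice-index currency `κ ⊕ κ` of that lemma). [cite: Lange2023AbelianVarietiesComplex, §1.5.1 and §1.3 Exercise 1.3.4 (9)] -/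
theorem intGram_nsmul_of_isNSForm {η : (κ → ℂ) [⋀^Fin 2]→L[ℝ] ℝ} (hη : IsNSForm Φ η) :
    ∀ n : ℕ, intGram Φ (n • η) = n • intGram Φ η
  | 0 => by
    have h0 : IsNSForm Φ (0 : (κ → ℂ) [⋀^Fin 2]→L[ℝ] ℝ) := (mem_neronSeveriGroup_iff Φ).1 (neronSeveriGroup Φ).zero_mem
    have h := intGram_add_of_isNSForm (Φ := Φ) h0 h0
    rw [add_zero, left_eq_add] at h
    rw [zero_smul, zero_smul, h]
  | n + 1 => by
    have hn : IsNSForm Φ (n • η) :=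
      (mem_neronSeveriGroup_iff Φ).1 ((neronSeveriGroup Φ).nsmul_mem ((mem_neronSeveriGroup_iff Φ).2 hη) n)
    rw [add_smul, one_smul, intGram_add_of_isNSForm (Φ := Φ) hn hη, intGram_nsmul_of_isNSForm hη n, add_smul, one_smul]

end IntGram

end Literature.Geometry.Kaehler.ComplexTorus

/-! ### §2. Algebraic side: `[𝒪(n • D)] = [𝒪(D)]ⁿ` and translation-invariance of `D′ − n•D` from `φ_{D′} = φ_Dⁿ` -/

namespace Literature.AlgebraicGeometry.Motives

namespace CartierDivisor

universe u

variable {Y : Scheme.{u}} [IsIntegral Y] (D : CartierDivisor Y)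

/-- **`[𝒪_Y(n • D)] = [𝒪_Y(D)]ⁿ` in `Ȟ¹(Y, 𝒪_Y^×)`**: `(m + 1) • D` and `m • D + D` present the same divisor (`f_i^{m+1}/(f_a^m f_b)`
are units), `D ↦ [𝒪_Y(D)]` is additive (★ `cechClass_add`), `0 • D ∼ 0 • D + 0 • D`; induction.
[cite: GortzWedhorn2020, Section (11.9) and Prop. 11.21 (pp. 301–302)] -/
theorem cechClass_nsmul : ∀ m : ℕ, (m • D).cechClass = D.cechClass ^ m
  | 0 => by
    have h0 : (0 • D).LinEquiv (0 • D + 0 • D) :=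
      SameDivisor.linEquiv fun i p x _ _ ↦ by
        change IsUnitAt x (D.f i ^ 0 / (D.f p.1 ^ 0 * D.f p.2 ^ 0))
        rw [pow_zero, pow_zero, pow_zero, mul_one, div_one]
        exact isUnitAt_one
    have h := (cechClass_eq_iff_linEquiv _ _).2 h0
    rw [cechClass_add] at h
    rw [pow_zero]
    exact left_eq_mul.1 h
  | m + 1 => by
    have h1 : ((m + 1) • D).LinEquiv (m • D + D) :=
      SameDivisor.linEquiv fun i p x hi hp ↦ by
        change IsUnitAt x (D.f i ^ (m + 1) / (D.f p.1 ^ m * D.f p.2))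
        rw [pow_succ, mul_div_mul_comm, ← div_pow]
        exact ((D.isUnitAt_div i p.1 x hi hp.1).pow m).mul (D.isUnitAt_div i p.2 x hi hp.2)
    rw [(cechClass_eq_iff_linEquiv _ _).2 h1, cechClass_add, cechClass_nsmul m, pow_succ]

end CartierDivisor

namespace AbelianVariety

variable (A : AbelianVariety ℂ)

/-- **`φ_{[𝒪(D′)]} = φ_{[𝒪(D)]}ⁿ ⇒ D′ − n•D` is translation invariant**: if `t_x^*[D′]·[D′]⁻¹ = (t_x^*[D]·[D]⁻¹)ⁿ` for every
`x ∈ A(ℂ)` ([Lange2023AbelianVarietiesComplex] Prop. 1.4.6 (b): `φ` is a homomorphism in the bundle), then the divisor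
`F := D′ + (−(n • D))` satisfies `t_x^* F ∼ F` for all `x` (`[𝒪(F)] = [D′]·[D]⁻ⁿ` by ★ `cechClass_add`/`cechClass_neg_eq_inv`/
`cechClass_nsmul`, `t_x^*` is a homomorphism on `Ȟ¹`, and ★ `cechClass_eq_iff_linEquiv`).
[cite: Lange2023AbelianVarietiesComplex, §1.4.2 Prop. 1.4.6 (b) (p. 38)] [cite: MumfordAV1970, §8 (definition of `φ_L`, `K(L)`)] -/
theorem linEquiv_pullback_translation_of_phiPic_eq_pow (D D' : CartierDivisor A.X.left) (n : ℕ)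
    (h : ∀ x : A.Points ℂ, phiPic A D'.cechClass x = phiPic A D.cechClass x ^ n) (x : A.Points ℂ) :
    ((D' + -(n • D)).pullback (A.translation x).left).LinEquiv (D' + -(n • D)) := by
  rw [← CartierDivisor.cechClass_eq_iff_linEquiv, CartierDivisor.cechClass_pullback, CartierDivisor.cechClass_add,
    cechClass_neg_eq_inv, CartierDivisor.cechClass_nsmul, map_mul, map_inv, map_pow, ← div_eq_mul_inv,
    ← div_eq_mul_inv, div_eq_div_iff_mul_eq_mul]
  have hx := h x
  unfold phiPic at hx
  rw [div_pow, div_eq_div_iff_mul_eq_mul] at hx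
  rw [hx, mul_comm]

end AbelianVariety

end Literature.AlgebraicGeometry.Motives

/-! ### §3. THE JUNCTION: `φ_{[𝒪(D′)]} = φ_{[𝒪(D)]}ⁿ` on `A(ℂ)` ⇒ `H′ = n • H` for the Appell–Humbert forms -/

namespace Literature.AlgebraicGeometry.HodgeTheory

section Junction

variable {ι : Type} [Fintype ι] [DecidableEq ι] (A : AbelianVariety ℂ) {Φ : (ι → ℝ) ≃L[ℝ] (Fin A.dim → ℂ)}
  {φ : ComplexTorus Φ → ComplexPoints A.X} (hφ : IsAnalytification (Fin A.dim → ℂ) A.X A.dim φ)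
  (hadd : ∀ x y, φ (x + y) = φ x * φ y)

include hadd

/-- **THE (J) JUNCTION — an algebraic `φ`-identity fixes the Appell–Humbert form.**  On a complex abelian variety `A`
uniformised by `φ : V/Λ → A(ℂ)` (compatible with the group laws), let `D, D′` be Cartier divisors with
`φ_{[𝒪(D′)]}(x) = φ_{[𝒪(D)]}(x)ⁿ` for every `x ∈ A(ℂ)`, and let `(H, χ)`, `(H′, χ′)` be Appell–Humbert data of
`𝒪(D)^an`, `𝒪(D′)^an` on the torus.  Then `H′ = n • H`: `D′ − n•D` is translation invariant (§2), so `[𝒪(D′ − n•D)^an] ∈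
Pic⁰(X)` ([MumfordAV1970] §8 (iv)⇒(i) through ★ `picClass_cartierDivisorLineBundle_mem_picZero`), i.e.
`[L(H′,χ′)] = [L(H,χ)]ⁿ · c` with `c₁(c) = 0` (★ `picClass_cartierDivisorLineBundle_add/_neg/_nsmul`), and §1 concludes.
[cite: MumfordAV1970, §8 ((iv) ⇒ (i)) and the definition of `φ_L`] [cite: Lange2023AbelianVarietiesComplex, §1.3.1 Thm. 1.3.3, §1.4.1 Prop. 1.4.1, §1.4.2 Prop. 1.4.6 (b)] -/
theorem AbelianVariety.form_eq_nsmul_form_of_phiPic_cechClass_eq_pow (D D' : CartierDivisor A.X.left) (n : ℕ)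
    (h : ∀ x : A.Points ℂ, phiPic A D'.cechClass x = phiPic A D.cechClass x ^ n) (p p' : AHData Φ)
    (hp : AHData.toPic p = picClass (cartierDivisorLineBundle hφ D))
    (hp' : AHData.toPic p' = picClass (cartierDivisorLineBundle hφ D')) : p'.form = n • p.form := by
  have hmem := picClass_cartierDivisorLineBundle_mem_picZero A hφ hadd (D' + -(n • D))
    (Motives.AbelianVariety.linEquiv_pullback_translation_of_phiPic_eq_pow A D D' n h)
  refine ComplexTorus.AHData.form_eq_nsmul_of_toPic_eq p p' n hmem ?_
  rw [hp', hp, picClass_cartierDivisorLineBundle_add hφ, picClass_cartierDivisorLineBundle_neg hφ,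
    picClass_cartierDivisorLineBundle_nsmul hφ, mul_left_comm, mul_inv_cancel, mul_one]

end Junction

section JunctionGram

variable (A : AbelianVariety ℂ) {Φ : (Fin A.dim ⊕ Fin A.dim → ℝ) ≃L[ℝ] (Fin A.dim → ℂ)}
  {φ : ComplexTorus Φ → ComplexPoints A.X} (hφ : IsAnalytification (Fin A.dim → ℂ) A.X A.dim φ)
  (hadd : ∀ x y, φ (x + y) = φ x * φ y)

include hadd

/-- **(J) in the N3-core currency** (lattice index `Fin A.dim ⊕ Fin A.dim`): under the same hypotheses the INTEGER GRAM
MATRICES satisfy `intGram Φ H′ = n • intGram Φ H` (`H = p.form ∈ NS(X)`, ★ `intGram_add_of_isNSForm`).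
[cite: Lange2023AbelianVarietiesComplex, §1.5.1 and §1.4.2 Prop. 1.4.6 (b)] [cite: MumfordAV1970, §8 ((iv) ⇒ (i))] -/
theorem AbelianVariety.intGram_form_eq_nsmul_of_phiPic_cechClass_eq_pow (D D' : CartierDivisor A.X.left) (n : ℕ)
    (h : ∀ x : A.Points ℂ, phiPic A D'.cechClass x = phiPic A D.cechClass x ^ n) (p p' : AHData Φ)
    (hp : AHData.toPic p = picClass (cartierDivisorLineBundle hφ D))
    (hp' : AHData.toPic p' = picClass (cartierDivisorLineBundle hφ D')) :
    intGram Φ p'.form = n • intGram Φ p.form := by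
  rw [AbelianVariety.form_eq_nsmul_form_of_phiPic_cechClass_eq_pow A hφ hadd D D' n h p p' hp hp',
    intGram_nsmul_of_isNSForm p.isNSForm_form]

end JunctionGram

end Literature.AlgebraicGeometry.HodgeTheory

end
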